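import Summits.Schanuel.Schanuel.Theorems.ZilberEacBranchEqualOrderGrowth
import Summits.Schanuel.Schanuel.Theorems.ZilberEacCurveGraphFibreCase
import Summits.Schanuel.Schanuel.Theorems.ZilberEacEllipticBaseExample
import Mathlib.RingTheory.Polynomial.Eisenstein.Basic
import HarnessLib

/-!
# Arbitrary base branches, XVII: FERMAT CURVES AS BASE — for every `n ≥ 2`, `ζⁿ = −1` non-real,
# `θ ≠ 0`: `{x₀ⁿ + x₁ⁿ = 1, y₀ = x₁ − ζx₀ + θ}` is in Mantova–Masser's case AND dense

HONEST FRAMING.  Cell `pub-schanuel` (Zilber's Exponential-Algebraic Closedness, case ladder;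
host summit Schanuel), seat 2, gen 28.  Mantova–Masser's own example (fermat) in PLMS 2024 §1 p. 5
has the Fermat nonic `X₁⁹ + X₂⁹ = 1` as base (with the fibre `X̂₁ + X̂₂ = 1`, a different fibre type,
decided by seat 1's `EACDensityQuestion`).  Here: the Fermat curve `F_n : x₀ⁿ + x₁ⁿ = 1` (`n ≥ 2`,
genus `(n−1)(n−2)/2`) has the asymptotic directions `[1 : ζ : 0]`, `ζⁿ = −1`; along the branch
`x₀ = 1/s`, `x₁ = ζ(1 − sⁿ)^{1/n}/s` the pole orders are EQUAL and the direction `ζ` is non-real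
for, e.g., `ζ = e^{iπ/n}`.  With the graph fibre `y₀ = x₁ − ζx₀ + θ → θ`, file XV (growth alone)
and the certificates VI, VIII give **`unprojectedDensityQuestion_fermat_graphFibre`**: for every
`n ≥ 2`, every `ζ` with `ζⁿ = −1`, `Im ζ ≠ 0`, and every `θ ≠ 0`, the surface
`{x₀ⁿ + x₁ⁿ − 1 = 0, y₀ = x₁ − ζx₀ + θ}` is in Mantova–Masser's case AND has Zariski-dense exponential
points.  (Irreducibility of `tⁿ + (sⁿ − 1)`: Eisenstein at the prime `(s − 1)` of `ℂ[s]`.)  Decided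
instances of an OPEN question (Mantova–Masser, PLMS 2024 §1 p. 5); EC(3,2) OPEN; NOT Schanuel's
conjecture (neither used nor implied); EAC ⇏ SC.
-/

noncomputable section

open Filter Topology Set Complex MvPolynomial
open Literature.NumberTheory.Transcendental Literature.ModelTheory.Zilber
open Literature.ModelTheory.ExponentialFields

set_option linter.dupNamespace false

namespace Summit.Schanuel.Schanuel.Theorems

section Fermat

variable (n : ℕ)

/-! ## Part A. The Fermat curve is irreducible (Eisenstein at `s − 1`) -/

/-- `(X − 1)² ∤ Xⁿ − 1` in `ℂ[X]` for `n ≥ 1` (the root `1` is simple). [folklore] -/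
theorem X_sub_one_sq_not_dvd_X_pow_sub_one (hn : 1 ≤ n) :
    ¬ (Polynomial.X - Polynomial.C (1 : ℂ)) ^ 2 ∣ (Polynomial.X ^ n - 1 : Polynomial ℂ) := by
  rintro ⟨q, hq⟩
  have hd := congrArg (fun p : Polynomial ℂ => (Polynomial.derivative p).eval 1) hq
  simp only [Polynomial.derivative_sub, Polynomial.derivative_one,
    sub_zero, Polynomial.derivative_mul, Polynomial.derivative_pow, Polynomial.derivative_X,
    Polynomial.derivative_C, Polynomial.eval_mul, Polynomial.eval_pow, Polynomial.eval_sub,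
    Polynomial.eval_X, Polynomial.eval_C, Polynomial.eval_add,
    sub_self, mul_one, one_pow] at hd
  norm_num at hd
  exact (Nat.cast_ne_zero.2 (by omega : n ≠ 0)) hd

/-- The Fermat relation `tⁿ + (sⁿ − 1)` is irreducible in `ℂ[s][t]` for `n ≥ 1` (Eisenstein at the
prime `(s − 1)`). [folklore] -/
theorem irreducible_fermat_row (hn : 1 ≤ n) :
    Irreducible (Polynomial.X ^ n + Polynomial.C (Polynomial.X ^ n - 1 : Polynomial ℂ)) := by
  set f : Polynomial (Polynomial ℂ) := Polynomial.X ^ n + Polynomial.C (Polynomial.X ^ n - 1) with hf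
  set P : Ideal (Polynomial ℂ) := Ideal.span {Polynomial.X - Polynomial.C (1 : ℂ)} with hP
  have hPprime : P.IsPrime := by
    rw [hP, Ideal.span_singleton_prime (Polynomial.X_sub_C_ne_zero 1)]
    exact Polynomial.prime_X_sub_C 1
  have hmonic : f.Monic := by
    rw [hf]
    exact Polynomial.monic_X_pow_add_C _ (by omega)
  have hdeg : f.natDegree = n := by
    rw [hf, Polynomial.natDegree_X_pow_add_C]
  have hdvd : (Polynomial.X - Polynomial.C (1 : ℂ)) ∣ (Polynomial.X ^ n - 1 : Polynomial ℂ) := by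
    rw [Polynomial.dvd_iff_isRoot]
    simp
  have heis : f.IsEisensteinAt P := by
    refine ⟨?_, fun {j} hj => ?_, ?_⟩
    · rw [hmonic.leadingCoeff]
      intro h1
      have : P = ⊤ := (Ideal.eq_top_iff_one P).2 h1
      exact hPprime.ne_top this
    · rw [hdeg] at hj
      rw [hf, Polynomial.coeff_add, Polynomial.coeff_X_pow, if_neg (by omega), zero_add,
        Polynomial.coeff_C]
      split_ifs with h0
      · exact Ideal.mem_span_singleton.2 hdvd
      · exact Ideal.zero_mem _
    · rw [hf, Polynomial.coeff_add, Polynomial.coeff_X_pow, if_neg (by omega), zero_add,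
        Polynomial.coeff_C_zero, hP, Ideal.span_singleton_pow, Ideal.mem_span_singleton]
      exact X_sub_one_sq_not_dvd_X_pow_sub_one n hn
  exact heis.irreducible hPprime hmonic.isPrimitive (by rw [hdeg]; omega)

/-- Evaluation of `x₀ⁿ + x₁ⁿ − 1`. -/
theorem eval_fermatMv (x : Fin 2 → ℂ) :
    MvPolynomial.eval x (X 0 ^ n + X 1 ^ n - 1 : MvPolynomial (Fin 2) ℂ) = x 0 ^ n + x 1 ^ n - 1 := by
  simp

/-- Evaluation of `x₁ − ζ x₀ + θ`. -/
theorem eval_fermatFibreMv (ζ θ : ℂ) (x : Fin 2 → ℂ) :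
    MvPolynomial.eval x (X 1 - MvPolynomial.C ζ * X 0 + MvPolynomial.C θ : MvPolynomial (Fin 2) ℂ) =
      x 1 - ζ * x 0 + θ := by
  simp

/-- The Fermat polynomial and its rows. -/
theorem eval_fermatMv_rows (x y : ℂ) :
    MvPolynomial.eval ![x, y] (X 0 ^ n + X 1 ^ n - 1 : MvPolynomial (Fin 2) ℂ) =
      ((Polynomial.X ^ n + Polynomial.C (Polynomial.X ^ n - 1 : Polynomial ℂ)).map
        (Polynomial.evalRingHom x)).eval y := by
  rw [eval_fermatMv]
  simp
  ring

/-- The Fermat polynomial `x₀ⁿ + x₁ⁿ − 1` is irreducible in `ℂ[x₀, x₁]` (`n ≥ 1`). [folklore] -/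
theorem irreducible_fermatMv (hn : 1 ≤ n) :
    Irreducible (X 0 ^ n + X 1 ^ n - 1 : MvPolynomial (Fin 2) ℂ) :=
  (irreducible_rows_iff (eval_fermatMv_rows n)).2 (irreducible_fermat_row n hn)

/-! ## Part B. The branch `x₀ = 1/s`, `x₁ = ζ(1 − sⁿ)^{1/n}/s` and density -/

/-- The analytic data: `q(v) = (1 − v)^{1/n}` (principal), `q(0) = 1`, `q(v)ⁿ = 1 − v` near `0`, and
the difference quotient `d` with `q(v) = 1 + v·d(v)`. [folklore] -/
theorem fermat_branch_facts (hn : 1 ≤ n) :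
    ∃ q d : ℂ → ℂ, AnalyticAt ℂ q 0 ∧ AnalyticAt ℂ d 0 ∧ q 0 = 1 ∧ (∀ v, q v = 1 + v * d v) ∧
      ∀ᶠ v in 𝓝 (0 : ℂ), q v ^ n = 1 - v := by
  have hnC : (n : ℂ) ≠ 0 := Nat.cast_ne_zero.2 (by omega)
  set q : ℂ → ℂ := fun v => Complex.exp ((1 / (n : ℂ)) * Complex.log (1 - v)) with hq
  have h1v : AnalyticAt ℂ (fun v : ℂ => 1 - v) 0 := analyticAt_const.sub analyticAt_id
  have hqan : AnalyticAt ℂ q 0 :=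
    (analyticAt_const.mul (h1v.clog (by simp [Complex.one_mem_slitPlane]))).cexp
  have hq0 : q 0 = 1 := by simp [hq]
  set d : ℂ → ℂ := dslope q 0 with hd
  have hdan : AnalyticAt ℂ d 0 := by
    obtain ⟨p, hp⟩ := hqan
    exact ⟨_, hp.has_fpower_series_dslope_fslope⟩
  have hqd : ∀ v, q v = 1 + v * d v := fun v => by
    have h := eq_add_mul_dslope q v
    rwa [hq0] at h
  have hsmall : ∀ᶠ v in 𝓝 (0 : ℂ), ‖v‖ < 1 := by
    have := Metric.ball_mem_nhds (0 : ℂ) one_pos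
    filter_upwards [this] with v hv
    rwa [Metric.mem_ball, dist_zero_right] at hv
  refine ⟨q, d, hqan, hdan, hq0, hqd, ?_⟩
  filter_upwards [hsmall] with v hv
  have hslit : 1 - v ∈ Complex.slitPlane := by
    have : 1 + (-v) ∈ Complex.slitPlane := Complex.mem_slitPlane_of_norm_lt_one (by rwa [norm_neg])
    rwa [← sub_eq_add_neg] at this
  have hne0 : 1 - v ≠ 0 := Complex.slitPlane_ne_zero hslit
  rw [hq]
  simp only
  rw [← Complex.exp_nat_mul, ← mul_assoc, show ((n : ℕ) : ℂ) * (1 / (n : ℂ)) = 1 by field_simp,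
    one_mul]
  exact Complex.exp_log hne0

variable {n}

/-- **Over the Fermat curve `x₀ⁿ + x₁ⁿ = 1` (`n ≥ 2`), the surface `y₀ = x₁ − ζx₀ + θ` (`ζⁿ = −1`,
`Im ζ ≠ 0`, `θ ≠ 0`) has Zariski-dense exponential points.**
[cite: MantovaMasser2023, §1 Further remarks, p. 5 (the question, open in general)] (new) -/
theorem unprojectedDense_fermat_graphFibre (hn : 2 ≤ n) {ζ : ℂ} (hζ : ζ ^ n = -1) (hζim : ζ.im ≠ 0)
    {θ : ℂ} (hθ : θ ≠ 0) :
    UnprojectedDense {w : Fin 2 ⊕ Fin 2 → ℂ |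
      MvPolynomial.eval ![w (Sum.inl 0), w (Sum.inl 1)] (X 0 ^ n + X 1 ^ n - 1 : MvPolynomial (Fin 2) ℂ) = 0 ∧
      w (Sum.inr 0) = MvPolynomial.eval ![w (Sum.inl 0), w (Sum.inl 1)]
        (X 1 - MvPolynomial.C ζ * X 0 + MvPolynomial.C θ : MvPolynomial (Fin 2) ℂ)} := by
  have hn1 : 1 ≤ n := by omega
  have hS := isIrreducibleClosed_curveGraphFibre
    (X 1 - MvPolynomial.C ζ * X 0 + MvPolynomial.C θ : MvPolynomial (Fin 2) ℂ) (irreducible_fermatMv n hn1)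
  have hdim := zariskiDim_curveGraphFibre
    (X 1 - MvPolynomial.C ζ * X 0 + MvPolynomial.C θ : MvPolynomial (Fin 2) ℂ) (irreducible_fermatMv n hn1)
  obtain ⟨q, d, hqan, hdan, hq0, hqd, hqn⟩ := fermat_branch_facts n hn1
  -- `Φ(s) = ζ q(sⁿ)`, `ψ(s) = θ + ζ s^{n-1} d(sⁿ)`
  set Φ : ℂ → ℂ := fun s => ζ * q (s ^ n) with hΦ
  set ψ : ℂ → ℂ := fun s => θ + ζ * (s ^ (n - 1) * d (s ^ n)) with hψ
  have hsn : AnalyticAt ℂ (fun s : ℂ => s ^ n) 0 := analyticAt_id.pow n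
  have h0n : (0 : ℂ) ^ n = 0 := zero_pow (by omega)
  have hΦan : AnalyticAt ℂ Φ 0 := analyticAt_const.mul (hqan.comp_of_eq hsn h0n)
  have hψan : AnalyticAt ℂ ψ 0 :=
    analyticAt_const.add (analyticAt_const.mul ((analyticAt_id.pow (n - 1)).mul
      (hdan.comp_of_eq hsn h0n)))
  have hΦim : (Φ 0).im ≠ 0 := by simp [hΦ, h0n, hq0, hζim]
  have hψ0 : ψ 0 = θ := by simp [hψ, zero_pow (by omega : n - 1 ≠ 0)]
  have hqn' : ∀ᶠ s in 𝓝 (0 : ℂ), q (s ^ n) ^ n = 1 - s ^ n := by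
    have h := hsn.continuousAt.tendsto
    rw [h0n] at h
    exact h.eventually hqn
  have hgerm : ∀ᶠ s in 𝓝[≠] (0 : ℂ),
      (Sum.elim ![(s ^ 1)⁻¹, Φ s * (s ^ 1)⁻¹] ![ψ s, Complex.exp (Φ s * (s ^ 1)⁻¹)] :
        Fin 2 ⊕ Fin 2 → ℂ) ∈ {w : Fin 2 ⊕ Fin 2 → ℂ |
      MvPolynomial.eval ![w (Sum.inl 0), w (Sum.inl 1)] (X 0 ^ n + X 1 ^ n - 1 : MvPolynomial (Fin 2) ℂ) = 0 ∧
      w (Sum.inr 0) = MvPolynomial.eval ![w (Sum.inl 0), w (Sum.inl 1)]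
        (X 1 - MvPolynomial.C ζ * X 0 + MvPolynomial.C θ : MvPolynomial (Fin 2) ℂ)} := by
    filter_upwards [self_mem_nhdsWithin, nhdsWithin_le_nhds hqn'] with s (hs : s ≠ 0) hqs
    refine ⟨?_, ?_⟩
    · simp only [Sum.elim_inl, Matrix.cons_val_zero, Matrix.cons_val_one]
      rw [eval_fermatMv]
      simp only [Matrix.cons_val_zero, Matrix.cons_val_one, pow_one, hΦ]
      rw [mul_pow, mul_pow, hζ, hqs, inv_pow]
      have hsn0 : s ^ n ≠ 0 := pow_ne_zero _ hs
      field_simp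
      ring
    · simp only [Sum.elim_inr, Sum.elim_inl, Matrix.cons_val_zero, Matrix.cons_val_one]
      rw [eval_fermatFibreMv]
      simp only [Matrix.cons_val_one, Matrix.cons_val_zero, pow_one, hΦ, hψ]
      have hd' := hqd (s ^ n)
      have e : s ^ n = s * s ^ (n - 1) := by
        rw [← pow_succ', Nat.sub_add_cancel hn1]
      field_simp
      rw [hd', e]
      ring
  exact unprojectedDense_branch_equalOrder_of_im_ne_zero hS (le_of_eq hdim) (le_refl 1) hψan hθ hψ0
    hΦan hΦim hgerm

/-! ## Part C. The case certificate, and case ∧ dense -/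

/-- **The Fermat example is in Mantova–Masser's case (dim-π-S-1-free)** (`n ≥ 2`, `ζ` non-real,
every `θ`). (new) -/
theorem mmCase_fermat_graphFibre (hn : 2 ≤ n) {ζ : ℂ} (hζim : ζ.im ≠ 0) (θ : ℂ) :
    MMCaseDimPiOneFree {w : Fin 2 ⊕ Fin 2 → ℂ |
      MvPolynomial.eval ![w (Sum.inl 0), w (Sum.inl 1)] (X 0 ^ n + X 1 ^ n - 1 : MvPolynomial (Fin 2) ℂ) = 0 ∧
      w (Sum.inr 0) = MvPolynomial.eval ![w (Sum.inl 0), w (Sum.inl 1)]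
        (X 1 - MvPolynomial.C ζ * X 0 + MvPolynomial.C θ : MvPolynomial (Fin 2) ℂ)} := by
  have hn1 : 1 ≤ n := by omega
  have hn0 : n ≠ 0 := by omega
  refine mmCase_curveGraphFibre (irreducible_fermatMv n hn1) ?_ ?_
  · -- `(1, 0)` has `R = θ − ζ`, `(0, 1)` has `R = 1 + θ`; both vanish only if `ζ = −1` (real)
    by_cases h : θ - ζ ≠ 0
    · refine ⟨![1, 0], by rw [eval_fermatMv]; simp [hn0], ?_⟩
      rw [eval_fermatFibreMv]
      simp only [Matrix.cons_val_one, Matrix.cons_val_zero, mul_one, zero_sub]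
      intro h'; apply h; linear_combination h'
    · push Not at h
      refine ⟨![0, 1], by rw [eval_fermatMv]; simp [hn0], ?_⟩
      rw [eval_fermatFibreMv]
      simp only [Matrix.cons_val_one, Matrix.cons_val_zero, mul_zero, sub_zero]
      intro h'
      have : ζ = -1 := by linear_combination h' - h
      apply hζim
      rw [this]; simp
  · -- `(1, 0)`, `(0, 1)`, `(ω, 0)` with `ω = e^{2πi/n} ≠ 1`, `ωⁿ = 1`: not collinear
    intro m hm c
    have hω := Complex.isPrimitiveRoot_exp n hn0
    set ω : ℂ := Complex.exp (2 * Real.pi * I / n) with hωdef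
    have hωn : ω ^ n = 1 := hω.pow_eq_one
    have hω1 : ω ≠ 1 := hω.ne_one (by omega)
    by_cases h1 : (m 0 : ℂ) * 1 + (m 1 : ℂ) * 0 ≠ c
    · exact ⟨![1, 0], by rw [eval_fermatMv]; simp [hn0], by simpa using h1⟩
    by_cases h2 : (m 0 : ℂ) * 0 + (m 1 : ℂ) * 1 ≠ c
    · exact ⟨![0, 1], by rw [eval_fermatMv]; simp [hn0], by simpa using h2⟩
    push Not at h1 h2
    refine ⟨![ω, 0], ?_, ?_⟩
    · rw [eval_fermatMv]; simp [hn0, hωn]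
    · simp only [Matrix.cons_val_zero, Matrix.cons_val_one, mul_zero, add_zero]
      intro h3
      have hm0c : (m 0 : ℂ) = c := by simpa using h1
      have hm1c : (m 1 : ℂ) = c := by simpa using h2
      have hc : c * (ω - 1) = 0 := by rw [← hm0c] at h3 ⊢; linear_combination h3 - hm0c + hm0c
      rcases mul_eq_zero.1 hc with hc0 | hω0
      · apply hm
        funext i
        fin_cases i
        · exact_mod_cast (hm0c.trans hc0)
        · exact_mod_cast (hm1c.trans hc0)
      · exact hω1 (by linear_combination hω0)

/-- **Mantova–Masser's question over Fermat curves: case ∧ dense** (`n ≥ 2`, `ζⁿ = −1`, `Im ζ ≠ 0`,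
`θ ≠ 0`). [cite: MantovaMasser2023, §1 Further remarks, p. 5 (the question, open in general)] (new) -/
theorem unprojectedDensityQuestion_fermat_graphFibre (hn : 2 ≤ n) {ζ : ℂ} (hζ : ζ ^ n = -1)
    (hζim : ζ.im ≠ 0) {θ : ℂ} (hθ : θ ≠ 0) :
    MMCaseDimPiOneFree {w : Fin 2 ⊕ Fin 2 → ℂ |
        MvPolynomial.eval ![w (Sum.inl 0), w (Sum.inl 1)] (X 0 ^ n + X 1 ^ n - 1 : MvPolynomial (Fin 2) ℂ) = 0 ∧
        w (Sum.inr 0) = MvPolynomial.eval ![w (Sum.inl 0), w (Sum.inl 1)]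
          (X 1 - MvPolynomial.C ζ * X 0 + MvPolynomial.C θ : MvPolynomial (Fin 2) ℂ)} ∧
      UnprojectedDense {w : Fin 2 ⊕ Fin 2 → ℂ |
        MvPolynomial.eval ![w (Sum.inl 0), w (Sum.inl 1)] (X 0 ^ n + X 1 ^ n - 1 : MvPolynomial (Fin 2) ℂ) = 0 ∧
        w (Sum.inr 0) = MvPolynomial.eval ![w (Sum.inl 0), w (Sum.inl 1)]
          (X 1 - MvPolynomial.C ζ * X 0 + MvPolynomial.C θ : MvPolynomial (Fin 2) ℂ)} :=
  ⟨mmCase_fermat_graphFibre hn hζim θ, unprojectedDense_fermat_graphFibre hn hζ hζim hθ⟩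

/-- **Plain coordinates**: `{x₀ⁿ + x₁ⁿ = 1, y₀ = x₁ − ζx₀ + θ}` is in the case AND dense.
[cite: MantovaMasser2023, §1 Further remarks, p. 5 (the question, open in general)] (new) -/
theorem unprojectedDensityQuestion_fermat_graphFibre' (hn : 2 ≤ n) {ζ : ℂ} (hζ : ζ ^ n = -1)
    (hζim : ζ.im ≠ 0) {θ : ℂ} (hθ : θ ≠ 0) :
    MMCaseDimPiOneFree {w : Fin 2 ⊕ Fin 2 → ℂ |
        w (Sum.inl 0) ^ n + w (Sum.inl 1) ^ n - 1 = 0 ∧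
        w (Sum.inr 0) = w (Sum.inl 1) - ζ * w (Sum.inl 0) + θ} ∧
      UnprojectedDense {w : Fin 2 ⊕ Fin 2 → ℂ |
        w (Sum.inl 0) ^ n + w (Sum.inl 1) ^ n - 1 = 0 ∧
        w (Sum.inr 0) = w (Sum.inl 1) - ζ * w (Sum.inl 0) + θ} := by
  have e : {w : Fin 2 ⊕ Fin 2 → ℂ |
        MvPolynomial.eval ![w (Sum.inl 0), w (Sum.inl 1)] (X 0 ^ n + X 1 ^ n - 1 : MvPolynomial (Fin 2) ℂ) = 0 ∧
        w (Sum.inr 0) = MvPolynomial.eval ![w (Sum.inl 0), w (Sum.inl 1)]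
          (X 1 - MvPolynomial.C ζ * X 0 + MvPolynomial.C θ : MvPolynomial (Fin 2) ℂ)} =
      {w : Fin 2 ⊕ Fin 2 → ℂ | w (Sum.inl 0) ^ n + w (Sum.inl 1) ^ n - 1 = 0 ∧
        w (Sum.inr 0) = w (Sum.inl 1) - ζ * w (Sum.inl 0) + θ} := by
    ext w
    simp only [Set.mem_setOf_eq, eval_fermatMv, eval_fermatFibreMv, Matrix.cons_val_zero,
      Matrix.cons_val_one]
  have h := unprojectedDensityQuestion_fermat_graphFibre hn hζ hζim hθ
  rw [e] at h
  exact h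

/-- **Example: the Fermat nonic of Mantova–Masser's example (fermat) as base**, with `ζ = e^{iπ/9}`:
`{x₀⁹ + x₁⁹ = 1, y₀ = x₁ − e^{iπ/9}x₀ + 1}` is in the case AND dense. (new) -/
theorem unprojectedDensityQuestion_fermatNonic_graphFibre :
    MMCaseDimPiOneFree {w : Fin 2 ⊕ Fin 2 → ℂ |
        w (Sum.inl 0) ^ 9 + w (Sum.inl 1) ^ 9 - 1 = 0 ∧
        w (Sum.inr 0) = w (Sum.inl 1) - Complex.exp (Real.pi * I / 9) * w (Sum.inl 0) + 1} ∧
      UnprojectedDense {w : Fin 2 ⊕ Fin 2 → ℂ |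
        w (Sum.inl 0) ^ 9 + w (Sum.inl 1) ^ 9 - 1 = 0 ∧
        w (Sum.inr 0) = w (Sum.inl 1) - Complex.exp (Real.pi * I / 9) * w (Sum.inl 0) + 1} := by
  have hζ : Complex.exp (Real.pi * I / 9) ^ 9 = -1 := by
    rw [← Complex.exp_nat_mul, show ((9 : ℕ) : ℂ) * (Real.pi * I / 9) = Real.pi * I by push_cast; ring,
      Complex.exp_pi_mul_I]
  have hζim : (Complex.exp (Real.pi * I / 9)).im ≠ 0 := by
    rw [show (Real.pi * I / 9 : ℂ) = ((Real.pi / 9 : ℝ) : ℂ) * I by push_cast; ring,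
      Complex.exp_ofReal_mul_I_im]
    exact (Real.sin_pos_of_pos_of_lt_pi (by positivity) (by linarith [Real.pi_pos])).ne'
  exact unprojectedDensityQuestion_fermat_graphFibre' (by norm_num) hζ hζim one_ne_zero

end Fermat

end Summit.Schanuel.Schanuel.Theorems
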